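import Mathlib
import HarnessLib
import Summits.ResolutionOfSingularities.ResolutionOfSingularities.Theorems.WildQuotientsWildQuotientResolutionConductorOneAction
import Summits.ResolutionOfSingularities.ResolutionOfSingularities.Theorems.WildQuotientsWildQuotientResolutionConductorOneFrameChartMap

/-!
# S2 brick F3c-3 — the FRAME of the conductor-𝟙 core: the chart map `β_I : Aₙ → M_I` is INJECTIVE

(crux stmt-ResolutionOfSingularities-15640 `WildQuotients.WildQuotientResolution`, line `Sketch`; chain w45c post-V5
programme S2, design `L/res-L1-w45c-lead-1/S2-DESIGN.md` §1/§7; res-L1-w45c-plan-1 NO OBJECTION 2026-08-27T18:26:16Z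
(F3c). [OURS · L1 W4.5c] — NOT a statement of any manuscript; replaces the role of no printed item; AI-produced, weaker
than expert review. Def-free, law form. Prover res-D-pv-033.)

The substitution `uᵢ ↦ s`, `u_l ↦ s/(1+c_l)` (`l ∈ I∖i`), `u_l ↦ s e_l/(1+e_l)` (`l ∉ I`) is birational: in the field
`K = k(x)` the substitution `xᵢ ↦ xᵢ`, `x_l ↦ xᵢ/x_l − 1` (`l ∈ I∖i`), `x_l ↦ x_l/(xᵢ − x_l)` (`l ∉ I`) kills no factor of
`h_M` (`rho_chartDen_ne_zero`), hence extends to `ρ : M_I → K` (`exists_rho`), and `ρ ∘ β_I` is the canonical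
embedding `Aₙ ⊆ k[u] ⊆ K`-wise identity on coordinates (`rho_comp_beta_U`). Hence (`chartMap_injective`) **every
`β : Aₙ →ₐ[k] M_I` with the chart laws is injective** — the hypothesis `hβ` of the cover engine
`BlowupExit.exists_ringEquiv_subalgebra_of_coverData_deg`.
-/

-- single-problem summit: the doubled namespace component `ResolutionOfSingularities` is forced
set_option linter.dupNamespace false

noncomputable section

open MvPolynomial

namespace Summit.ResolutionOfSingularities.ResolutionOfSingularities.Theorems.WildQuotientResolution.ConductorOne

variable (k : Type) [Field k] (p n : ℕ) [Fact p.Prime] (i : Fin n) (I : Finset (Fin n))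

/-! ## Non-vanishing in `K = k(x)` -/

/-- the coordinate `x_l` in `K = Frac k[x]` -/
local notation3 (prettyPrint := false) "xK" l =>
  (algebraMap (MvPolynomial (Fin n) k) (FractionRing (MvPolynomial (Fin n) k)) (X l))

omit [Fact p.Prime] in
/-- `x_l ≠ 0` in `K`. [folklore] -/
theorem xK_ne_zero (l : Fin n) : (xK l) ≠ 0 := fun h =>
  X_ne_zero l (IsFractionRing.injective (MvPolynomial (Fin n) k) (FractionRing (MvPolynomial (Fin n) k))
    (h.trans (map_zero _).symm))

omit [Fact p.Prime] in
/-- `xᵢ − x_l ≠ 0` in `K` for `l ≠ i`. [folklore] -/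
theorem xK_sub_ne_zero (l : Fin n) (hl : l ≠ i) : (xK i) - (xK l) ≠ 0 := by
  rw [← map_sub]
  intro h
  have h0 : (X i - X l : MvPolynomial (Fin n) k) = 0 :=
    IsFractionRing.injective (MvPolynomial (Fin n) k) (FractionRing (MvPolynomial (Fin n) k))
      (h.trans (map_zero _).symm)
  exact hl (MvPolynomial.X_injective (sub_eq_zero.mp h0)).symm

/-- `1 − x_l^{p−1} ≠ 0` in `K`. [folklore] -/
theorem one_sub_xK_pow_ne_zero (l : Fin n) : 1 - (xK l) ^ (p - 1) ≠ 0 := by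
  have hp1 : p - 1 ≠ 0 := by have := (Fact.out : p.Prime).two_le; omega
  rw [← map_pow, ← map_one (algebraMap (MvPolynomial (Fin n) k) (FractionRing (MvPolynomial (Fin n) k))),
    ← map_sub]
  intro h
  have h0 : (1 - X l ^ (p - 1) : MvPolynomial (Fin n) k) = 0 :=
    IsFractionRing.injective (MvPolynomial (Fin n) k) (FractionRing (MvPolynomial (Fin n) k))
      (h.trans (map_zero _).symm)
  have hc := congrArg (MvPolynomial.eval fun _ : Fin n => (0 : k)) h0
  rw [map_sub, map_one, map_pow, MvPolynomial.eval_X, zero_pow hp1, sub_zero, map_zero] at hc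
  exact one_ne_zero hc

/-! ## The inverse substitution `ρ₀ : k[x] → K` and its extension to `M_I` -/

/-- **`ρ₀(h_M) ≠ 0`**, where `ρ₀ : xᵢ ↦ xᵢ`, `x_l ↦ xᵢ/x_l − 1` (`l ∈ I∖i`), `x_l ↦ x_l/(xᵢ − x_l)` (`l ∉ I`).
[OURS · L1 W4.5c] -/
theorem rho_chartDen_ne_zero (hi : i ∈ I) :
    MvPolynomial.aeval (R := k) (S₁ := FractionRing (MvPolynomial (Fin n) k))
        (fun l : Fin n => if l = i then (xK i) else if l ∈ I then (xK i) / (xK l) - 1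
          else (xK l) / ((xK i) - (xK l)))
        (chartDen k p n i I) ≠ 0 := by
  set v : Fin n → FractionRing (MvPolynomial (Fin n) k) := fun l : Fin n =>
    if l = i then (xK i) else if l ∈ I then (xK i) / (xK l) - 1 else (xK l) / ((xK i) - (xK l)) with hv
  have hvi : v i = (xK i) := by simp [v]
  have hvI : ∀ l ∈ I.erase i, v l = (xK i) / (xK l) - 1 := fun l hl => by
    obtain ⟨hli, hlI⟩ := Finset.mem_erase.mp hl; simp [v, hli, hlI]
  have hvO : ∀ l ∉ I, v l = (xK l) / ((xK i) - (xK l)) := fun l hl => by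
    have hli : l ≠ i := fun h => hl (h ▸ hi); simp [v, hli, hl]
  have hxi := xK_ne_zero k n i
  unfold chartDen
  rw [map_mul, map_mul, map_prod, map_prod]
  refine mul_ne_zero ?_ (mul_ne_zero ?_ ?_)
  · simpa only [map_sub, map_one, map_pow, MvPolynomial.aeval_X, hvi] using one_sub_xK_pow_ne_zero k p n i
  · refine Finset.prod_ne_zero_iff.mpr fun l hl => ?_
    have hxl := xK_ne_zero k n l
    have h1 : (1 + v l) = (xK i) / (xK l) := by rw [hvI l hl, add_sub_cancel]
    simp only [map_mul, map_sub, map_add, map_one, map_pow, MvPolynomial.aeval_X, hvi, h1]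
    refine mul_ne_zero (div_ne_zero hxi hxl) ?_
    -- `((xᵢ/x_l)^{p−1} − xᵢ^{p−1}) · x_l^{p−1} = xᵢ^{p−1} (1 − x_l^{p−1})`
    have key : (((xK i) / (xK l)) ^ (p - 1) - (xK i) ^ (p - 1)) * (xK l) ^ (p - 1) =
        (xK i) ^ (p - 1) * (1 - (xK l) ^ (p - 1)) := by
      rw [sub_mul, ← mul_pow, div_mul_cancel₀ _ hxl, mul_sub, mul_one, ← mul_pow]
    intro h0
    rw [h0, zero_mul] at key
    exact mul_ne_zero (pow_ne_zero _ hxi) (one_sub_xK_pow_ne_zero k p n l) key.symm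
  · refine Finset.prod_ne_zero_iff.mpr fun l hl => ?_
    have hlI : l ∉ I := (Finset.mem_sdiff.mp hl).2
    have hli : l ≠ i := fun h => hlI (h ▸ hi)
    have hxil := xK_sub_ne_zero k n i l hli
    have h1 : (1 + v l) = (xK i) / ((xK i) - (xK l)) := by
      rw [hvO l hlI, one_add_div hxil, sub_add_cancel]
    simp only [map_mul, map_sub, map_add, map_one, map_pow, MvPolynomial.aeval_X, hvi, h1]
    rw [hvO l hlI]
    refine mul_ne_zero (div_ne_zero hxi hxil) ?_
    have key : (((xK i) / ((xK i) - (xK l))) ^ (p - 1) - ((xK i) * ((xK l) / ((xK i) - (xK l)))) ^ (p - 1)) *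
          ((xK i) - (xK l)) ^ (p - 1) = (xK i) ^ (p - 1) * (1 - (xK l) ^ (p - 1)) := by
      rw [sub_mul, ← mul_pow, ← mul_pow, div_mul_cancel₀ _ hxil, mul_assoc, div_mul_cancel₀ _ hxil, mul_sub,
        mul_one, ← mul_pow]
    intro h0
    rw [h0, zero_mul] at key
    exact mul_ne_zero (pow_ne_zero _ hxi) (one_sub_xK_pow_ne_zero k p n l) key.symm

/-- **The chart laws force injectivity**: every `β : Aₙ →ₐ[k] M_I` with `β uᵢ = s`, `β u_l (1+X_l) = s` (`l ∈ I∖i`),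
`β u_l (1+X_l) = s X_l` (`l ∉ I`) is injective (`i ∈ I`). [OURS · L1 W4.5c] -/
theorem chartMap_injective (hi : i ∈ I) (β : CoreRing k p n →ₐ[k] ChartRing k p n i I)
    (h1 : β (coreU k p n i) = chartX k p n i I i)
    (h2 : ∀ l ∈ I.erase i, β (coreU k p n l) * (1 + chartX k p n i I l) = chartX k p n i I i)
    (h3 : ∀ l ∉ I, β (coreU k p n l) * (1 + chartX k p n i I l) = chartX k p n i I i * chartX k p n i I l) :
    Function.Injective β := by
  -- the inverse substitution and its extension `ρ : M_I → K`
  set v : Fin n → FractionRing (MvPolynomial (Fin n) k) := fun l : Fin n =>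
    if l = i then (xK i) else if l ∈ I then (xK i) / (xK l) - 1 else (xK l) / ((xK i) - (xK l)) with hv
  have hvi : v i = (xK i) := by simp [v]
  have hvI : ∀ l ∈ I.erase i, v l = (xK i) / (xK l) - 1 := fun l hl => by
    obtain ⟨hli, hlI⟩ := Finset.mem_erase.mp hl; simp [v, hli, hlI]
  have hvO : ∀ l ∉ I, v l = (xK l) / ((xK i) - (xK l)) := fun l hl => by
    have hli : l ≠ i := fun h => hl (h ▸ hi); simp [v, hli, hl]
  let ρ₀ : MvPolynomial (Fin n) k →ₐ[k] FractionRing (MvPolynomial (Fin n) k) := MvPolynomial.aeval v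
  have hρ₀h : IsUnit (ρ₀ (chartDen k p n i I)) :=
    isUnit_iff_ne_zero.mpr (rho_chartDen_ne_zero k p n i I hi)
  let ρ : ChartRing k p n i I →+* FractionRing (MvPolynomial (Fin n) k) :=
    IsLocalization.Away.lift (chartDen k p n i I) (g := (ρ₀ : _ →+* _)) hρ₀h
  have hρX : ∀ l, ρ (chartX k p n i I l) = v l := by
    intro l
    change IsLocalization.Away.lift (chartDen k p n i I) hρ₀h (algebraMap _ _ (X l)) = v l
    rw [IsLocalization.Away.lift_eq]
    exact MvPolynomial.aeval_X v l
  have hxi := xK_ne_zero k n i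
  -- `ρ ∘ β` is the canonical map on the coordinates
  have hρβ : ∀ l, ρ (β (coreU k p n l)) = (xK l) := by
    intro l
    by_cases hli : l = i
    · subst hli; rw [h1, hρX, hvi]
    by_cases hlI : l ∈ I
    · have hl : l ∈ I.erase i := Finset.mem_erase.mpr ⟨hli, hlI⟩
      have h := congrArg ρ (h2 l hl)
      rw [map_mul, map_add, map_one, hρX, hρX, hvi, hvI l hl, add_sub_cancel] at h
      have hxl := xK_ne_zero k n l
      -- `ρβu_l · (xᵢ/x_l) = xᵢ` ⇒ `ρβu_l · xᵢ = x_l · xᵢ`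
      have h' := congrArg (· * (xK l)) h
      simp only [mul_assoc, div_mul_cancel₀ _ hxl] at h'
      rw [mul_comm (xK i) (xK l)] at h'
      exact mul_right_cancel₀ hxi h'
    · have h := congrArg ρ (h3 l hlI)
      have hxil := xK_sub_ne_zero k n i l hli
      rw [map_mul, map_mul, map_add, map_one, hρX, hρX, hvi, hvO l hlI, one_add_div hxil, sub_add_cancel] at h
      -- `ρβu_l · xᵢ/(xᵢ−x_l) = xᵢ · x_l/(xᵢ−x_l)` ⇒ multiply by `xᵢ − x_l`
      have h' := congrArg (· * ((xK i) - (xK l))) h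
      simp only [mul_assoc, div_mul_cancel₀ _ hxil] at h'
      rw [mul_comm (xK i) (xK l)] at h'
      exact mul_right_cancel₀ hxi h'
  -- hence `ρ ∘ β ∘ (k[u] → Aₙ)` is the (injective) structure map `k[x] → K`
  have hcomp : (ρ.comp (β : CoreRing k p n →+* ChartRing k p n i I)).comp
      (algebraMap (MvPolynomial (Fin n) k) (CoreRing k p n)) =
      algebraMap (MvPolynomial (Fin n) k) (FractionRing (MvPolynomial (Fin n) k)) := by
    refine MvPolynomial.ringHom_ext (fun c => ?_) (fun l => ?_)
    · have e1 : algebraMap (MvPolynomial (Fin n) k) (CoreRing k p n) (C c) = algebraMap k (CoreRing k p n) c := by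
        rw [IsScalarTower.algebraMap_apply k (MvPolynomial (Fin n) k) (CoreRing k p n)]; rfl
      have e2 : algebraMap k (ChartRing k p n i I) c =
          algebraMap (MvPolynomial (Fin n) k) (ChartRing k p n i I) (C c) := by
        rw [IsScalarTower.algebraMap_apply k (MvPolynomial (Fin n) k) (ChartRing k p n i I)]; rfl
      have e3 : algebraMap k (FractionRing (MvPolynomial (Fin n) k)) c =
          algebraMap (MvPolynomial (Fin n) k) (FractionRing (MvPolynomial (Fin n) k)) (C c) := by
        rw [IsScalarTower.algebraMap_apply k (MvPolynomial (Fin n) k) (FractionRing (MvPolynomial (Fin n) k))]; rfl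
      rw [RingHom.comp_apply, RingHom.comp_apply, RingHom.coe_coe, e1, AlgHom.commutes, e2]
      change IsLocalization.Away.lift (chartDen k p n i I) hρ₀h (algebraMap _ _ (C c)) = _
      rw [IsLocalization.Away.lift_eq]
      change ρ₀ (C c) = _
      rw [MvPolynomial.algHom_C, e3]
    · rw [RingHom.comp_apply, RingHom.comp_apply, RingHom.coe_coe]
      exact hρβ l
  have hinj0 : Function.Injective ((β : CoreRing k p n →+* ChartRing k p n i I).comp
      (algebraMap (MvPolynomial (Fin n) k) (CoreRing k p n))) := by
    intro a b hab
    have h := congrArg ρ hab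
    have ha := congrArg (fun f => f a) hcomp
    have hb := congrArg (fun f => f b) hcomp
    simp only [RingHom.comp_apply] at ha hb h
    rw [ha, hb] at h
    exact IsFractionRing.injective (MvPolynomial (Fin n) k) (FractionRing (MvPolynomial (Fin n) k)) h
  -- and `β` itself is injective (`Aₙ` is the localisation at `Dₙ`)
  rw [injective_iff_map_eq_zero]
  intro z hz
  obtain ⟨⟨x, s⟩, hzr⟩ := IsLocalization.surj (Submonoid.powers (coreDenominator k p n)) z
  change z * algebraMap _ _ (s : MvPolynomial (Fin n) k) = algebraMap _ _ x at hzr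
  have hx : ((β : CoreRing k p n →+* ChartRing k p n i I).comp (algebraMap (MvPolynomial (Fin n) k)
      (CoreRing k p n))) x = 0 := by
    rw [RingHom.comp_apply, ← hzr, RingHom.coe_coe, map_mul, hz, zero_mul]
  have hx0 : x = 0 := hinj0 (by rw [hx, map_zero])
  rw [hx0, map_zero] at hzr
  exact (IsLocalization.map_units (CoreRing k p n) s).mul_left_eq_zero.mp hzr

end Summit.ResolutionOfSingularities.ResolutionOfSingularities.Theorems.WildQuotientResolution.ConductorOne

end
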